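import Mathlib
import HarnessLib
import Summits.HubbardSuperconductivity.HubbardSuperconductivity.Theorems.KLProgrammeKLRegimeTwoVolumeResummedSymbolSizes
import Summits.HubbardSuperconductivity.HubbardSuperconductivity.Theorems.KLProgrammeKLRegimeTwoVolumeReadoutPin
import Summits.HubbardSuperconductivity.HubbardSuperconductivity.Theorems.KLProgrammePerturbedFermiCurveExplicit
import Summits.HubbardSuperconductivity.HubbardSuperconductivity.Theorems.KLProgrammeKLRegimeEngineScaleZeroE4Bands
import Summits.HubbardSuperconductivity.HubbardSuperconductivity.Theorems.KLProgrammeH10TwoPointLimitFramePerturbation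

/-!
# K3 two-volume read-out, work-order (r4) — TURNKEY: the explicit-symbol numbers keyed to an ADMISSIBLE frame (`FrameOK`) in the KL regime

Cell gate-hubbard-kl, seat hubbard-kl-k3c5-p1 (g8).  `…TwoVolumeResummedSymbolSizes.resummedSymbolSizes_of_band` bounds the three explicit quantities of
k3c5-p2's read-out (`‖τ̌‖₁`, `M₁(τ̌)`, far|c_{Re E}|) from a graded band size `‖Dⁱe_K‖ ≤ Dⁱ` (`1 ≤ i ≤ 3`), the non-vanishing `1 + u·K ≠ 0` on the lattice
and the frame-kernel numbers `κ, κ₁`.  Here the first two inputs are DISCHARGED for an admissible frame in the KL regime: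

* `frameLevel_eq_frameLevel_zero_add_frameShift`, `norm_iteratedFDeriv_frameLevel_le_add` — `‖Dⁱe_K‖ ≤ 4ⁱ + ‖DⁱD_K‖` (bare band: [tree]
  `norm_iteratedFDeriv_frameLevel_zero_le_pow`);
* **`band_graded_of_frameOK`** — `‖Dⁱ(frameLevel μ K)‖ ≤ (5 + Gfr₃U²·4^{N+1}/3)ⁱ`, `1 ≤ i ≤ 3`, `N = nScales β`, from [tree] `frame_sizes_of_frameOK_explicit`
  (`A ≤ 1/20` at orders `≤ 2`, `A₃ = Gfr₃U²4^{N+1}/3` at order `3`);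
* **`one_add_sampled_mul_ne_zero`** — `1 + u(p_k⃗)·K(p_k⃗) ≠ 0` at every Matsubara frequency (my `one_add_uvSymbolCT_mul_ne_zero` read through k3c5-p2's
  `uvSymbolCT_eq_mul_sampled`);
* **`resummedSymbolSizes_of_frameOK`** — the three numbers for `FrameOK R U (nScales β) μ K` in the regime `0 < c ≤ klCurveC3 R`, `0 < U ≤ klCurveU0 R`,
  `klBetaMin ≤ β ≤ e^{c/U²}`, `μ ∈ klWindowC`, at `ω = ω_i`, scale parameter `0 < Λ ≤ 4`, cutoff bound `B`, frame-kernel numbers `κ, κ₁` (p3's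
  `sum_norm_framePosKernel_le_…` / `sum_abs_mul_norm_framePosKernel_le_of_frameOK` + `sum_tnorm_norm_framePosKernel_le`), under `A·κ < 1`.

Proofs only; no definitions; nothing about the model beyond identities.
-/

noncomputable section

namespace Summit.HubbardSuperconductivity.HubbardSuperconductivity.Theorems.TwoVolumeDefect

set_option linter.dupNamespace false -- summit = problem name (single-conjunct summit), D-0017

open Finset Complex Literature.MathematicalPhysics.QuantumLattice Literature.Probability.LatticeModels
open Summit.HubbardSuperconductivity.HubbardSuperconductivity.Theorems.KLRegimeSplit
open Summit.HubbardSuperconductivity.HubbardSuperconductivity.Theorems.DispersionFlow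
open Summit.HubbardSuperconductivity.HubbardSuperconductivity.Theorems.PerturbedFermiCurve
open scoped ComplexConjugate

/-! ## §1 Band sizes of an admissible frame -/

section Band

/-- `e_K = e_0 + D_K` as functions on `Momentum`. -/
theorem frameLevel_eq_frameLevel_zero_add_frameShift (μ : ℝ) (K : TrigPolyC4v) : frameLevel μ K = frameLevel μ 0 + frameShift K := by
  funext q
  simp [frameLevel, frameShift]
  ring

/-- `‖Dⁱe_K‖ ≤ 4ⁱ + ‖DⁱD_K‖` for `i ≥ 1`. -/
theorem norm_iteratedFDeriv_frameLevel_le_add (μ : ℝ) (K : TrigPolyC4v) {i : ℕ} (hi : 1 ≤ i) {Ai : ℝ}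
    (hA : ∀ p, ‖iteratedFDeriv ℝ i (frameShift K) p‖ ≤ Ai) (p : Momentum) :
    ‖iteratedFDeriv ℝ i (frameLevel μ K) p‖ ≤ (4 : ℝ) ^ i + Ai := by
  rw [frameLevel_eq_frameLevel_zero_add_frameShift,
    iteratedFDeriv_add_apply ((EngineV8.contDiff_frameLevel μ 0).contDiffAt) ((contDiff_frameShift K).contDiffAt)]
  exact (norm_add_le _ _).trans (add_le_add (EngineV8.norm_iteratedFDeriv_frameLevel_zero_le_pow μ hi p) (hA p))

/-- **Graded band size of an admissible frame in the KL regime**: `‖Dⁱ(frameLevel μ K)‖ ≤ (5 + Gfr₃U²·4^{N+1}/3)ⁱ` for `1 ≤ i ≤ 3`. -/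
theorem band_graded_of_frameOK {R : RenConsts} (hR : ∀ j, 0 ≤ R.Gfr j) {c : ℝ} (hc : 0 < c) (hcle : c ≤ klCurveC3 R)
    {U : ℝ} (hU : 0 < U) (hUle : U ≤ klCurveU0 R) {β : ℝ} (hβmin : klBetaMin ≤ β) (hβc : β ≤ Real.exp (c / U ^ 2))
    {μ : ℝ} (hμ : μ ∈ klWindowC) {K : TrigPolyC4v} (hK : FrameOK R U (nScales β) μ K) :
    ∀ i, 1 ≤ i → i ≤ 3 → ∀ p : Momentum,
      ‖iteratedFDeriv ℝ i (frameLevel μ K) p‖ ≤ (5 + R.Gfr 3 * U ^ 2 * ((4 : ℝ) ^ (nScales β + 1) / 3)) ^ i := by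
  obtain ⟨hAf, hA20, -, -, -, hA3f, -⟩ := frame_sizes_of_frameOK_explicit hR hc hcle hU hUle hβmin hβc hμ hK
  set A := 2 * R.Gfr 0 * |U| + 2 * R.Gfr 1 * U ^ 2 + R.Gfr 2 * (c / Real.log 4) with hA
  set A₃ := R.Gfr 3 * U ^ 2 * ((4 : ℝ) ^ (nScales β + 1) / 3) with hA₃
  have hA₃0 : 0 ≤ A₃ := by rw [hA₃]; have := hR 3; positivity
  intro i hi1 hi3 p
  interval_cases i
  · have h := norm_iteratedFDeriv_frameLevel_le_add μ K le_rfl (fun q => hAf q 1 (by norm_num)) p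
    calc _ ≤ (4 : ℝ) ^ 1 + A := h
      _ ≤ (5 + A₃) ^ 1 := by rw [pow_one, pow_one]; linarith
  · have h := norm_iteratedFDeriv_frameLevel_le_add μ K (by norm_num : 1 ≤ 2) (fun q => hAf q 2 le_rfl) p
    calc _ ≤ (4 : ℝ) ^ 2 + A := h
      _ ≤ (5 + A₃) ^ 2 := by nlinarith
  · have h := norm_iteratedFDeriv_frameLevel_le_add μ K (by norm_num : 1 ≤ 3) hA3f p
    calc _ ≤ (4 : ℝ) ^ 3 + A₃ := h
      _ ≤ (5 + A₃) ^ 3 := by nlinarith [sq_nonneg A₃, mul_nonneg hA₃0 hA₃0]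

end Band

/-! ## §2 The resummation denominator never vanishes at a Matsubara frequency -/

section Den

variable {L M : ℕ} [NeZero L]

/-- **`1 + u(p_k⃗)·K(p_k⃗) ≠ 0`** at `ω = ω_i` (`u q = uvSymbolFn 1 Λ (−2Σcos q_l − μ − K q) ω_i`): imaginary part `≠ 0`. -/
theorem one_add_sampled_mul_ne_zero {β : ℝ} (hβ : 0 < β) (μ : ℝ) (K : TrigPolyC4v) (Λ : ℝ) (i : MatsubaraIdx M) (k : TorusSite 2 L) :
    1 + uvSymbolFn 1 Λ (-2 * (∑ l : Fin 2, Real.cos (latticeMomentum L k l)) - μ - K.eval (latticeMomentum L k))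
        (matsubaraFreq β M i) * (K.eval (latticeMomentum L k) : ℂ) ≠ 0 := by
  have h := one_add_uvSymbolCT_mul_ne_zero (L := L) (M := M) hβ μ K Λ (((i, k), (0 : Fin 2)))
  rw [uvSymbolCT_eq_mul_sampled hβ μ K Λ i k 0] at h
  have hL : (0 : ℝ) < L := Nat.cast_pos.2 (Nat.pos_of_ne_zero (NeZero.ne L))
  have hβC : (β : ℂ) ≠ 0 := by exact_mod_cast hβ.ne'
  have hLC : (L : ℂ) ≠ 0 := by exact_mod_cast hL.ne'
  convert h using 2
  push_cast
  field_simp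

end Den

/-! ## §3 The turnkey corollary -/

section Turnkey

variable {b Lc Lf M : ℕ} [NeZero Lc] [NeZero Lf]

/-- **The explicit-symbol numbers of the two-volume read-out for an ADMISSIBLE frame in the KL regime.**  With
`D := 5 + Gfr₃U²·4^{nScales β+1}/3`, `A := 6(4B/Λ + 2πB(4/Λ)²D + 12π²B(4/Λ)³D²)`, `Mu := 12(2πB(4/Λ)²D + 12π²B(4/Λ)³D² + 144π³B(4/Λ)⁴D³)`,
frame-kernel numbers `Σ‖Ǩ_{Lf}‖ ≤ κ`, `Σ tnorm·‖Ǩ_{Lf}‖ ≤ κ₁` and `A·κ < 1`: at `ω = ω_i`,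
`‖τ̌‖₁ ≤ 1/(1 − Aκ)²`, `M₁(τ̌) ≤ 2(Mu·κ + A·κ₁)/(1 − Aκ)³`, `Σ_{far}|c_{Re E}| ≤ (κ₁/(1 − Aκ) + κ(Mu·κ + A·κ₁)/(1 − Aκ)²)/((Lc−1)/2+1)`. -/
theorem resummedSymbolSizes_of_frameOK (hL : Lf = b * Lc) {R : RenConsts} (hR : ∀ j, 0 ≤ R.Gfr j) {c : ℝ} (hc : 0 < c)
    (hcle : c ≤ klCurveC3 R) {U : ℝ} (hU : 0 < U) (hUle : U ≤ klCurveU0 R) {β : ℝ} (hβ : 0 < β) (hβmin : klBetaMin ≤ β)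
    (hβc : β ≤ Real.exp (c / U ^ 2)) {μ : ℝ} (hμ : μ ∈ klWindowC) {K : TrigPolyC4v} (hK : FrameOK R U (nScales β) μ K)
    {Λ : ℝ} (hΛ : 0 < Λ) (hΛ4 : Λ ≤ 4) {B : ℝ} (hB1 : 1 ≤ B) (hB : ∀ j ≤ 3, ∀ t, ‖iteratedDeriv j salmhoferCutoff t‖ ≤ B)
    (i : MatsubaraIdx M) {κ κ₁ : ℝ} (hκ : ∑ z : TorusSite 2 Lf, ‖framePosKernel Lf K z‖ ≤ κ)
    (hκ₁ : ∑ z : TorusSite 2 Lf, (Torus.tnorm z : ℝ) * ‖framePosKernel Lf K z‖ ≤ κ₁)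
    (hsmall : 6 * (B * (4 / Λ) + Real.pi * (2 * B * (4 / Λ) ^ 2 * (5 + R.Gfr 3 * U ^ 2 * ((4 : ℝ) ^ (nScales β + 1) / 3))) +
      Real.pi ^ 2 * (12 * B * (4 / Λ) ^ 3 * (5 + R.Gfr 3 * U ^ 2 * ((4 : ℝ) ^ (nScales β + 1) / 3)) ^ 2)) * κ < 1) :
    (∑ x : TorusSite 2 Lf, ‖torusFourierInv (fun k => (1 - (K.eval (latticeMomentum Lf k) : ℂ) *
        (uvSymbolFn 1 Λ (-2 * (∑ l : Fin 2, Real.cos (latticeMomentum Lf k l)) - μ - K.eval (latticeMomentum Lf k))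
            (matsubaraFreq β M i) /
          (1 + uvSymbolFn 1 Λ (-2 * (∑ l : Fin 2, Real.cos (latticeMomentum Lf k l)) - μ - K.eval (latticeMomentum Lf k))
            (matsubaraFreq β M i) * K.eval (latticeMomentum Lf k)))) ^ 2) x‖ ≤
        1 / (1 - 6 * (B * (4 / Λ) + Real.pi * (2 * B * (4 / Λ) ^ 2 * (5 + R.Gfr 3 * U ^ 2 * ((4 : ℝ) ^ (nScales β + 1) / 3))) +
          Real.pi ^ 2 * (12 * B * (4 / Λ) ^ 3 * (5 + R.Gfr 3 * U ^ 2 * ((4 : ℝ) ^ (nScales β + 1) / 3)) ^ 2)) * κ) ^ 2) ∧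
    (∑ x : TorusSite 2 Lf, (Torus.tnorm x : ℝ) * ‖torusFourierInv (fun k => (1 - (K.eval (latticeMomentum Lf k) : ℂ) *
        (uvSymbolFn 1 Λ (-2 * (∑ l : Fin 2, Real.cos (latticeMomentum Lf k l)) - μ - K.eval (latticeMomentum Lf k))
            (matsubaraFreq β M i) /
          (1 + uvSymbolFn 1 Λ (-2 * (∑ l : Fin 2, Real.cos (latticeMomentum Lf k l)) - μ - K.eval (latticeMomentum Lf k))
            (matsubaraFreq β M i) * K.eval (latticeMomentum Lf k)))) ^ 2) x‖ ≤
        2 * ((12 * (Real.pi * (2 * B * (4 / Λ) ^ 2 * (5 + R.Gfr 3 * U ^ 2 * ((4 : ℝ) ^ (nScales β + 1) / 3))) +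
              Real.pi ^ 2 * (12 * B * (4 / Λ) ^ 3 * (5 + R.Gfr 3 * U ^ 2 * ((4 : ℝ) ^ (nScales β + 1) / 3)) ^ 2) +
              Real.pi ^ 3 * (144 * B * (4 / Λ) ^ 4 * (5 + R.Gfr 3 * U ^ 2 * ((4 : ℝ) ^ (nScales β + 1) / 3)) ^ 3))) * κ +
            (6 * (B * (4 / Λ) + Real.pi * (2 * B * (4 / Λ) ^ 2 * (5 + R.Gfr 3 * U ^ 2 * ((4 : ℝ) ^ (nScales β + 1) / 3))) +
              Real.pi ^ 2 * (12 * B * (4 / Λ) ^ 3 * (5 + R.Gfr 3 * U ^ 2 * ((4 : ℝ) ^ (nScales β + 1) / 3)) ^ 2))) * κ₁) /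
          (1 - 6 * (B * (4 / Λ) + Real.pi * (2 * B * (4 / Λ) ^ 2 * (5 + R.Gfr 3 * U ^ 2 * ((4 : ℝ) ^ (nScales β + 1) / 3))) +
            Real.pi ^ 2 * (12 * B * (4 / Λ) ^ 3 * (5 + R.Gfr 3 * U ^ 2 * ((4 : ℝ) ^ (nScales β + 1) / 3)) ^ 2)) * κ) ^ 3) ∧
    (∑ y ∈ univ.filter (fun y : TorusSite 2 Lf => Torus.proj Lf (Torus.cRep (fun l => (((y l).val : ℕ) : ZMod Lc))) ≠ y),
        |torusCosCoeff Lf (fun k => ((K.eval (latticeMomentum Lf k) : ℂ) - (K.eval (latticeMomentum Lf k) : ℂ) ^ 2 *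
          (uvSymbolFn 1 Λ (-2 * (∑ l : Fin 2, Real.cos (latticeMomentum Lf k l)) - μ - K.eval (latticeMomentum Lf k))
              (matsubaraFreq β M i) /
            (1 + uvSymbolFn 1 Λ (-2 * (∑ l : Fin 2, Real.cos (latticeMomentum Lf k l)) - μ - K.eval (latticeMomentum Lf k))
              (matsubaraFreq β M i) * K.eval (latticeMomentum Lf k)))).re) y| ≤
      (κ₁ / (1 - 6 * (B * (4 / Λ) + Real.pi * (2 * B * (4 / Λ) ^ 2 * (5 + R.Gfr 3 * U ^ 2 * ((4 : ℝ) ^ (nScales β + 1) / 3))) +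
            Real.pi ^ 2 * (12 * B * (4 / Λ) ^ 3 * (5 + R.Gfr 3 * U ^ 2 * ((4 : ℝ) ^ (nScales β + 1) / 3)) ^ 2)) * κ) +
          κ * ((12 * (Real.pi * (2 * B * (4 / Λ) ^ 2 * (5 + R.Gfr 3 * U ^ 2 * ((4 : ℝ) ^ (nScales β + 1) / 3))) +
                Real.pi ^ 2 * (12 * B * (4 / Λ) ^ 3 * (5 + R.Gfr 3 * U ^ 2 * ((4 : ℝ) ^ (nScales β + 1) / 3)) ^ 2) +
                Real.pi ^ 3 * (144 * B * (4 / Λ) ^ 4 * (5 + R.Gfr 3 * U ^ 2 * ((4 : ℝ) ^ (nScales β + 1) / 3)) ^ 3))) * κ +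
              (6 * (B * (4 / Λ) + Real.pi * (2 * B * (4 / Λ) ^ 2 * (5 + R.Gfr 3 * U ^ 2 * ((4 : ℝ) ^ (nScales β + 1) / 3))) +
                Real.pi ^ 2 * (12 * B * (4 / Λ) ^ 3 * (5 + R.Gfr 3 * U ^ 2 * ((4 : ℝ) ^ (nScales β + 1) / 3)) ^ 2))) * κ₁) /
            (1 - 6 * (B * (4 / Λ) + Real.pi * (2 * B * (4 / Λ) ^ 2 * (5 + R.Gfr 3 * U ^ 2 * ((4 : ℝ) ^ (nScales β + 1) / 3))) +
              Real.pi ^ 2 * (12 * B * (4 / Λ) ^ 3 * (5 + R.Gfr 3 * U ^ 2 * ((4 : ℝ) ^ (nScales β + 1) / 3)) ^ 2)) * κ) ^ 2) /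
        (((Lc - 1) / 2 + 1 : ℕ) : ℝ)) := by
  have hD0 : 0 ≤ 5 + R.Gfr 3 * U ^ 2 * ((4 : ℝ) ^ (nScales β + 1) / 3) := by have := hR 3; positivity
  exact resummedSymbolSizes_of_band (ω := matsubaraFreq β M i) hL hΛ hΛ4 hB1 hB hD0
    (band_graded_of_frameOK hR hc hcle hU hUle hβmin hβc hμ hK)
    (fun k => one_add_sampled_mul_ne_zero hβ μ K Λ i k) hκ hκ₁ hsmall

end Turnkey

end Summit.HubbardSuperconductivity.HubbardSuperconductivity.Theorems.TwoVolumeDefect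

end
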